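import Mathlib
import HarnessLib
import Summits.NavierStokesRegularity.NavierStokesRegularity.Theorems.TaylorModelRungThreeCertificateFormat
import Summits.NavierStokesRegularity.NavierStokesRegularity.Theorems.TaylorModelRungThreeCertificateSoundBridge
import Summits.NavierStokesRegularity.NavierStokesRegularity.Theorems.TaylorModelRungThreeCertificateSoundField
import Summits.NavierStokesRegularity.NavierStokesRegularity.Theorems.TaylorModelRungThreeCertificateSoundNode
import Summits.NavierStokesRegularity.NavierStokesRegularity.Theorems.TaylorModelRungThreeCertificateSoundStep

/-!
# Crux K1b-DR (stmt-NavierStokesRegularity-23954), line `taylor-model` — certificate SOUNDNESS, part 5: the `Chain`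
# block from `checkChain = true`

`CertTables.chain_of_check`: for an exact ordered field `K`, a monotone ring map `φ : K →+* ℝ`, tables `T` with
`CoefOK φ T`, if the executable checker of the format file accepts (`T.checkChain = true`), the supplementary tail
test `T.checkPolyTails = true` holds (faces `l` beyond the listed functionals carry `|ctr| ≤ rad`, so that the
`∀ l`-quantified polytope clause is true at the junk indices — a gap of the v1 checker, closed here), and the
ENTRY-DECOMPOSITION clause `EntryClause` holds at every stage (it is not covered by `checkChain`; its finite reduction
needs the Farkas data of CERT-CONTRACT-23954 §4 and is the subject of a later part), then the interpreted record
`T.toCertData φ` satisfies `TaylorChain.CertData.Chain` — assembled from `node_of_checkNode` (part 3) and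
`step_of_checkStep` (part 4). CERT-CONTRACT-23954 v1 §3–§4. MODEL-lattice rung TL-M3; nothing here is a statement
about the Navier–Stokes equations.
-/

-- the sub-problem namespace repeats the summit name by design (D-0017)
set_option linter.dupNamespace false

namespace Summit.NavierStokesRegularity.NavierStokesRegularity.Theorems.TaylorModelCert

open scoped BigOperators
open Literature.Analysis.FluidPDE.TaoCascade Literature.Analysis.FluidPDE.TaoCascade.TaylorChain

namespace CertTables

section Defs

variable {K : Type} [Field K] [LinearOrder K]

/-- SUPPLEMENTARY TAIL TEST (closes a gap of the v1 `checkChainStage`): for every stage `j ≤ N₀` and every face index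
`l` at or beyond the number of listed functionals (where `ℓ j l = 0`), `|ctr j l| ≤ rad j l` — needed because the
polytope clauses of `Chain` quantify over all `l : ℕ`. Indices beyond both lists hold `0 ≤ 0` automatically. [folklore] -/
def checkPolyTails (T : CertTables K) : Bool :=
  allN (T.N₀ + 1) fun j =>
    allN (max (T.stage j).ctr.length (T.stage j).rad.length) fun l =>
      decide ((T.stage j).ell.length ≤ l → |vget (T.stage j).ctr l| ≤ vget (T.stage j).rad l)

end Defs

/-- The ENTRY-DECOMPOSITION clause of `Chain` at stage `j` (every point of the entry polytope is
`x j 0 + Cm j 0 ξ + e` with `ξ` in the `rP j 0`-box, `e` in the `E j 0`-ball, and `Cm ξ + e` in the `dm j`-ball), as a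
named predicate on a certificate record; NOT covered by `checkChain`. [folklore] -/
def EntryClause (d : CertData) (j : ℕ) : Prop :=
  ∀ q : (Fin 4 → ℤ → ℝ), (∀ l, |d.ℓ j l q - d.ctr j l| ≤ d.rad j l) → ∃ ξ e : (Fin 4 → ℤ → ℝ),
    (∀ i k, -d.Kb ≤ k → k ≤ d.Ka → |ξ i k| ≤ d.rP j 0 i k ∧ q i k = d.x j 0 i k + d.Cm j 0 ξ i k + e i k) ∧
      d.InBall j e (d.E j 0) ∧ d.InBall j (d.Cm j 0 ξ + e) (d.dm j)

section Chain

variable {K : Type} [Field K] [LinearOrder K] [IsStrictOrderedRing K] {φ : K →+* ℝ} (hφ : Monotone φ)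
  (T : CertTables K)
include hφ

omit [LinearOrder K] [IsStrictOrderedRing K] hφ in
/-- The functionals of the interpreted record on a table vector, evaluated exactly. [folklore] -/
theorem ell_vecR (j l : ℕ) (v : List K) : (T.toCertData φ).ℓ j l (T.vecR φ v) =
    φ (sumN T.n fun c => vget ((T.stage j).ell.getD l []) c * vget v c) := by
  show T.covR φ ((T.stage j).ell.getD l []) (T.vecR φ v) = _
  rw [T.covR_apply φ, sumN_eq, map_sum]
  exact Finset.sum_congr rfl fun c hc => by rw [T.wv_vecR φ v (Finset.mem_range.1 hc), map_mul]

omit [LinearOrder K] [IsStrictOrderedRing K] hφ in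
/-- Beyond the listed functionals, `ℓ j l = 0`. [folklore] -/
theorem ell_tail (j l : ℕ) (hl : (T.stage j).ell.length ≤ l) (y : Fin 4 → ℤ → ℝ) : (T.toCertData φ).ℓ j l y = 0 := by
  show T.covR φ ((T.stage j).ell.getD l []) y = 0
  rw [T.covR_apply φ, List.getD_eq_default _ _ hl]
  exact Finset.sum_eq_zero fun c _ => by simp [vget]

/-- **Soundness of the chain checker** (CERT-CONTRACT-23954 v1 §3): `checkChain = true`, the tail test and the
entry clauses give the `Chain` block of the interpreted certificate record. [folklore] -/
theorem chain_of_check (hco : T.CoefOK φ) (hC : T.checkChain = true) (hTail : T.checkPolyTails = true)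
    (hE : ∀ j, j ≤ T.N₀ → EntryClause (T.toCertData φ) j) : (T.toCertData φ).Chain := by
  intro j hj
  have hjlt : j < T.N₀ + 1 := Nat.lt_succ_of_le hj
  have hSt := (allN_eq_true.1 hC) j hjlt
  have hTl := (allN_eq_true.1 hTail) j hjlt
  simp only [checkChainStage, Bool.and_eq_true, decide_eq_true_eq] at hSt
  obtain ⟨⟨⟨⟨⟨⟨hS1, hTn0⟩, hTnS⟩, hEI0⟩, hpoly⟩, hnodes⟩, hsteps⟩ := hSt
  refine ⟨hS1, ?_, ?_, ?_, ?_, hE j hj, fun s' hs' => ?_, fun s' hs' => ?_⟩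
  · show φ (T.node j 0).Tn = 0
    rw [hTn0, map_zero]
  · show φ (T.node j (T.stage j).S).Tn ≤ φ T.τs
    exact hφ hTnS
  · show φ (T.node j 0).EI = 0
    rw [hEI0, map_zero]
  · -- the centre `x j 0` lies in the entry polytope, for every face index `l`
    intro l
    show |(T.toCertData φ).ℓ j l (T.vecR φ (T.node j 0).x) - φ (vget (T.stage j).ctr l)| ≤ φ (vget (T.stage j).rad l)
    by_cases hl : l < (T.stage j).ell.length
    · rw [T.ell_vecR, ← map_sub, ← map_abs hφ]
      exact hφ (of_decide_eq_true ((allN_eq_true.1 hpoly) l hl))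
    · rw [not_lt] at hl
      rw [T.ell_tail j l hl, zero_sub, abs_neg, ← map_abs hφ]
      by_cases hl' : l < max (T.stage j).ctr.length (T.stage j).rad.length
      · exact hφ (of_decide_eq_true ((allN_eq_true.1 hTl) l hl') hl)
      · rw [not_lt, max_le_iff] at hl'
        unfold vget
        rw [List.getD_eq_default _ _ hl'.1, List.getD_eq_default _ _ hl'.2, abs_zero]
  · exact T.node_of_checkNode hφ hco ((allN_eq_true.1 hnodes) s' (Nat.lt_succ_of_le hs')) rfl
  · exact T.step_of_checkStep hφ ((allN_eq_true.1 hsteps) s' hs') rfl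

end Chain

end CertTables

end Summit.NavierStokesRegularity.NavierStokesRegularity.Theorems.TaylorModelCert
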